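import Summits.QuantumFields.BalabanUV.T4Continuum.Support.NE7QbarIterL1Letter
import HarnessLib

/-!
# Support | NE7 (gen 95, brick (S2)-B2 of memo WEIGHT-CURRENCY-DEAD §7): THE ℓ¹ LETTERS OF THE FRAMES AND OF THE LINEARISED k-FOLD AVERAGE, k-FREE —
# `Σ_{periodBox N}‖framePotW L (j+1) W Y‖ ≤ dL(2nbRad+1)^d·(Σ_{m≤j} 3(L∕L^d)^m)·dirL1 Y` and `dirL1 (dirIter L (j+1) W Y) (periodBox N) ≤ (3(L∕L^d)^{j+1} + 2d·(…))·dirL1 Y`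

Cell `pub-balaban`, rung (B)+1 sub-cell t4, lineage `b2b-balaban-t4-ne7-p1` (CRUX PROVER NE7 #1 = OWNER of row NE7), generation 95.  Over B1 `NE7QbarIterL1Letter` (the straight tower in
ℓ¹), the structure theorem `NE3TangentCovariantTower.dirIter_eq_QbarIter_add_gaugeDir`, the closed form `NE3FramePotBoundW.framePotW_eq_sum`, leaf-10's word weights
(`AveragingDeficitPlaqLin.lnorm_le_region`) and the periodic counting `AveragingDeficitPeriodicCounting.sum_periodBox_box_le`.

WHY.  The ℓ¹ twin of Π-C-1 (`NE3LinearisedAverageSup`, sup letter `(3+12d)L^k`): the straight part of the linearised k-fold average CONTRACTS ℓ¹ by `(L∕L^d)^k` (B1) while the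
frame part does NOT contract (the frames read the field at the top-block corner chains with O(1) weights) — the exact mechanism behind the refuted weight currency (memo §1) and the
bookkeeping input of the direct ℓ¹ letter (S2) of the honest binder `hdecomp`.
WHAT ([folklore]; 0 def, 0 sorry).  §1 `sum_norm_Fbar_le` (one linearised frame in ℓ¹ on the torus: `Σ_{y∈periodBox M}‖Fbar L U Y y‖ ≤ dL·(2nbRad+1)^d·dirL1 Y (periodBox (L·M))`),
`sum_corner_le` ∕ `sum_corner_pow_le` (a corner sub-sum of a non-negative periodic function is below the full sum), `dirL1_gaugeDir_le` (`≤ 2d·Σ‖f‖`).  §2 **`sum_norm_framePotW_le`**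
(the accumulated frames in ℓ¹, through B1 level by level).  §4 (appended) `norm_Fbar_le_box`, **`sum_norm_framePotW_le_boxes`** (the frames read only the `nbRad`-boxes at the top-corner chains — the sharp input of (S2)).  §3 **`dirL1_dirIter_le`** (THE ℓ¹ LETTER of `dirIter`, k-free: `≤ (3(L∕L^d)^{j+1} + 2d·dL(2nbRad+1)^d·3·Σ_{m≤j}(L∕L^d)^m)·dirL1 Y`).
HONEST FRAMING (page 1): lattice kinematics on OUR frame; nothing of Bałaban's asserted; the remainder letters and `hdecomp` are NOT here; NE7 NOT PROVED; spine 0∕9; finite T⁴ rung (B)+1 —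
NOT infinite volume, NOT mass gap, NOT `BetaPertH`, NOT Clay.  Continuum YM on T⁴ ⇐ BetaPertH ∧ nine spine estimates (0/9 proved); BetaPertH ⇐ (D1) ∧ (D4) ∧ CAP+tail; G-an2-4 gates
asym, D1 and NE2/3/4.
-/

set_option autoImplicit false

open scoped BigOperators Matrix.Norms.L2Operator
open Finset

namespace Summit.QuantumFields.BalabanUV.T4Continuum.NE7DirIterL1Letter

open Literature.MathematicalPhysics.QuantumFieldTheory.Balaban1983to89
open B7Prop1Explicit B7Prop2Explicit
open T4AveragingDeficitWall (IsUnitaryCfg IsSkewDir SmallField dirL1 box Ad)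
open T4AveragingDeficitWallBoundary (IsPeriodicCfg periodBox sum_blocks_eq blockSites_periodBox)
open AveragingDeficitPeriodicCounting (IsPeriodicDir sum_periodBox_box_le)
open AveragingDeficitChartCalculus (cavg)
open AveragingDeficitTwoLevelPrep (twoLevelSmall prop1Radius)
open AveragingDeficitMultiLevelPrep (cavgIter radIter tower LevelSmall natCast_tower_succ isPeriodicCfg_cavgIter)
open AveragingDeficitDerivCore (dirL1_nonneg)
open AveragingDeficitTransport (lnorm norm_dhol_le norm_Ad_of_unitary)
open AveragingDeficitPlaqLin (lnorm_le_region)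
open BlockAverageVaryHolo (nbRad)
open BlockAveragePushDirGauge (gaugeDir)
open BlockAveragePushDirSplit (frameLin sum_blockWeight_eq_one)
open NE3TangentCovariantStructure (Qbar Fbar)
open NE3TangentCovariantTower (dirIter QbarIter framePotW dirIter_eq_QbarIter_add_gaugeDir QbarIter_zero)
open NE3FramePotBoundW (framePotW_eq_sum tower_eq_pow_mul isPeriodicDir_QbarIter levelSmall_of_le)
open NE3LinearisedAverageSup (curv curvSum levelData)
open NE7QbarIterL1Letter (dirL1_QbarIter_le_of_le)

noncomputable section
variable {d : ℕ} {n : Type*} [Fintype n] [DecidableEq n]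

/-! ## §1 One frame in `ℓ¹`; corner sub-sums; a gauge direction in `ℓ¹` -/

/-- **ONE LINEARISED FRAME IN `ℓ¹` ON THE TORUS**: for `U` unitary and an `(L·M)`-periodic `Y` (`L, M ≥ 1`),
`Σ_{y∈periodBox M}‖Fbar L U Y y‖ ≤ (d·L)·(2·nbRad+1)^d·dirL1 Y (periodBox (L·M))` — every tree contour has at most `dL` bonds inside the `nbRad`-box of its corner,
the block weights sum to one, and the boxes of the coarse corners cover the torus at most `(2nbRad+1)^d` times. [folklore] -/
theorem sum_norm_Fbar_le {L M : ℕ} (hL : 1 ≤ L) (hM : 1 ≤ M) {U : Site d → Fin d → (Matrix n n ℂ)ˣ} (hU : IsUnitaryCfg U)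
    {Y : Site d → Fin d → Matrix n n ℂ} (hY : IsPeriodicDir Y ((L : ℤ) * M)) :
    ∑ y ∈ periodBox (d := d) M, ‖Fbar L U Y y‖ ≤ ((d : ℝ) * L) * (2 * nbRad d L + 1) ^ d * dirL1 Y (periodBox (d := d) (L * M)) := by
  have hLM : 1 ≤ L * M := Nat.one_le_iff_ne_zero.mpr (Nat.mul_ne_zero (by omega) (by omega))
  have hwt := sum_blockWeight_eq_one (d := d) L hL
  -- pointwise: `‖Fbar y‖ ≤ dL · dirL1 Y (box nbRad (L•y))`
  have hpt : ∀ y : Site d, ‖Fbar L U Y y‖ ≤ ((d : ℝ) * L) * dirL1 Y (box (nbRad d L) ((L : ℤ) • y)) := by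
    intro y
    set q : Site d := (L : ℤ) • y with hq
    have hD0 : 0 ≤ dirL1 Y (box (nbRad d L) q) := dirL1_nonneg _ _
    show ‖frameLin L U Y q‖ ≤ _
    unfold frameLin
    calc ‖∑ r : Fin d → Fin L, (((L : ℝ) ^ d)⁻¹) • AveragingDeficitTransport.dhol U Y q (treeWord (boxVec L r))‖
        ≤ ∑ r : Fin d → Fin L, ‖(((L : ℝ) ^ d)⁻¹) • AveragingDeficitTransport.dhol U Y q (treeWord (boxVec L r))‖ := norm_sum_le _ _
      _ ≤ ∑ _r : Fin d → Fin L, ((L : ℝ) ^ d)⁻¹ * (((d : ℝ) * L) * dirL1 Y (box (nbRad d L) q)) := by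
          refine Finset.sum_le_sum fun r _ => ?_
          rw [norm_smul, Real.norm_eq_abs, abs_of_nonneg (by positivity)]
          refine mul_le_mul_of_nonneg_left ?_ (by positivity)
          have hlen : (treeWord (boxVec L r)).length ≤ d * L := by rw [length_treeWord]; exact l1_boxVec_le L r
          have h := lnorm_le_region Y (z := q) (q := q) (R := nbRad d L) (treeWord (boxVec L r))
            (by rw [BlockAverageVaryHolo.l1_sub_self, zero_add, length_treeWord, nbRad]; have := l1_boxVec_le L r; nlinarith)
          refine (norm_dhol_le hU Y _ _).trans (h.trans ?_)
          exact mul_le_mul_of_nonneg_right (by exact_mod_cast hlen) hD0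
      _ = ((d : ℝ) * L) * dirL1 Y (box (nbRad d L) q) := by rw [← Finset.sum_mul, hwt, one_mul]
  -- sum over the torus
  have hper : ∀ (x : Site d) (i : Fin d), (∑ κ : Fin d, ‖Y (x + ((L * M : ℕ) : ℤ) • e i) κ‖) = ∑ κ : Fin d, ‖Y x κ‖ := by
    intro x i
    refine Finset.sum_congr rfl fun κ _ => ?_
    rw [show (((L * M : ℕ) : ℤ)) = (L : ℤ) * M by push_cast; ring, hY x i κ]
  have hcount := sum_periodBox_box_le (d := d) L M hL hM (nbRad d L) (g := fun x => ∑ κ : Fin d, ‖Y x κ‖)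
    (fun x => Finset.sum_nonneg fun _ _ => norm_nonneg _) hper
  have hdL : 0 ≤ (d : ℝ) * L := by positivity
  calc ∑ y ∈ periodBox (d := d) M, ‖Fbar L U Y y‖
      ≤ ∑ y ∈ periodBox (d := d) M, ((d : ℝ) * L) * dirL1 Y (box (nbRad d L) ((L : ℤ) • y)) := Finset.sum_le_sum fun y _ => hpt y
    _ = ((d : ℝ) * L) * ∑ y ∈ periodBox (d := d) M, ∑ x ∈ box (nbRad d L) ((L : ℤ) • y), ∑ κ : Fin d, ‖Y x κ‖ := by
        rw [Finset.mul_sum]; rfl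
    _ ≤ ((d : ℝ) * L) * ((2 * nbRad d L + 1) ^ d * ∑ x ∈ periodBox (d := d) (L * M), ∑ κ : Fin d, ‖Y x κ‖) :=
        mul_le_mul_of_nonneg_left (by exact_mod_cast hcount) hdL
    _ = ((d : ℝ) * L) * (2 * nbRad d L + 1) ^ d * dirL1 Y (periodBox (d := d) (L * M)) := by unfold dirL1; ring

omit [Fintype n] [DecidableEq n] in
/-- **A CORNER SUB-SUM IS BELOW THE FULL SUM**: for `g ≥ 0`, `Σ_{y∈periodBox M} g (L•y) ≤ Σ_{x∈periodBox (L·M)} g x` (`L ≥ 1`; the blocks tile the big box). [folklore] -/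
theorem sum_corner_le {L M : ℕ} (hL : 1 ≤ L) {g : Site d → ℝ} (hg : ∀ x, 0 ≤ g x) :
    ∑ y ∈ periodBox (d := d) M, g ((L : ℤ) • y) ≤ ∑ x ∈ periodBox (d := d) (L * M), g x := by
  have htile := sum_blocks_eq (d := d) L hL (periodBox M) g
  rw [blockSites_periodBox L M hL] at htile
  rw [← htile]
  refine Finset.sum_le_sum fun y _ => ?_
  have h0 : boxVec L (fun _ : Fin d => (⟨0, by omega⟩ : Fin L)) = (0 : Site d) := by
    funext κ; simp [boxVec]
  calc g ((L : ℤ) • y) = g ((L : ℤ) • y + boxVec L (fun _ : Fin d => (⟨0, by omega⟩ : Fin L))) := by rw [h0, add_zero]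
    _ ≤ ∑ r : Fin d → Fin L, g ((L : ℤ) • y + boxVec L r) :=
        Finset.single_le_sum (f := fun r => g ((L : ℤ) • y + boxVec L r)) (fun r _ => hg _) (Finset.mem_univ _)

omit [Fintype n] [DecidableEq n] in
/-- The iterated corner sub-sum: `Σ_{z∈periodBox N} g ((L^a)•z) ≤ Σ_{x∈periodBox (tower L N a)} g x` for `g ≥ 0`. [folklore] -/
theorem sum_corner_pow_le {L N : ℕ} (hL : 1 ≤ L) : ∀ (a : ℕ) {g : Site d → ℝ}, (∀ x, 0 ≤ g x) →
    ∑ z ∈ periodBox (d := d) N, g (((L : ℤ) ^ a) • z) ≤ ∑ x ∈ periodBox (d := d) (tower L N a), g x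
  | 0, g, _ => by simp [tower]
  | a + 1, g, hg => by
      have h1 : ∑ z ∈ periodBox (d := d) N, g (((L : ℤ) ^ (a + 1)) • z) = ∑ z ∈ periodBox (d := d) N, (fun w => g ((L : ℤ) • w)) (((L : ℤ) ^ a) • z) := by
        refine Finset.sum_congr rfl fun z _ => ?_
        simp only [smul_smul, ← pow_succ']
      rw [h1]
      refine (sum_corner_pow_le hL a (g := fun w => g ((L : ℤ) • w)) (fun x => hg _)).trans ?_
      show ∑ x ∈ periodBox (d := d) (tower L N a), g ((L : ℤ) • x) ≤ ∑ x ∈ periodBox (d := d) (L * tower L N a), g x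
      exact sum_corner_le hL hg

/-- **A GAUGE DIRECTION IN `ℓ¹`**: for `U` unitary and an `N`-periodic site field `f` (`N ≥ 1`), `dirL1 (gaugeDir U f) (periodBox N) ≤ 2d·Σ_{periodBox N}‖f‖`. [folklore] -/
theorem dirL1_gaugeDir_le {N : ℕ} (hN : 1 ≤ N) {U : Site d → Fin d → (Matrix n n ℂ)ˣ} (hU : IsUnitaryCfg U) {f : Site d → Matrix n n ℂ}
    (hf : ∀ (x : Site d) (i : Fin d), f (x + (N : ℤ) • e i) = f x) :
    dirL1 (gaugeDir U f) (periodBox (d := d) N) ≤ 2 * d * ∑ z ∈ periodBox (d := d) N, ‖f z‖ := by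
  unfold dirL1
  have hpt : ∀ (z : Site d) (κ : Fin d), ‖gaugeDir U f z κ‖ ≤ ‖f z‖ + ‖f (z + e κ)‖ := by
    intro z κ
    unfold gaugeDir
    have hu : (U z κ)⁻¹ ∈ unitaryUnits (Matrix n n ℂ) := (unitaryUnits (Matrix n n ℂ)).inv_mem (hU z κ)
    calc ‖Ad (U z κ)⁻¹ (f z) - f (z + e κ)‖ ≤ ‖Ad (U z κ)⁻¹ (f z)‖ + ‖f (z + e κ)‖ := norm_sub_le _ _
      _ = ‖f z‖ + ‖f (z + e κ)‖ := by rw [norm_Ad_of_unitary hu]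
  have hshift : ∀ κ : Fin d, ∑ z ∈ periodBox (d := d) N, ‖f (z + e κ)‖ = ∑ z ∈ periodBox (d := d) N, ‖f z‖ := fun κ =>
    T4AveragingDeficitWallBoundary.sum_periodBox_shift N hN (g := fun z => ‖f z‖) (fun x i => by rw [hf x i]) (e κ)
  calc ∑ z ∈ periodBox (d := d) N, ∑ κ : Fin d, ‖gaugeDir U f z κ‖
      ≤ ∑ z ∈ periodBox (d := d) N, ∑ κ : Fin d, (‖f z‖ + ‖f (z + e κ)‖) :=
        Finset.sum_le_sum fun z _ => Finset.sum_le_sum fun κ _ => hpt z κ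
    _ = ∑ κ : Fin d, (∑ z ∈ periodBox (d := d) N, ‖f z‖ + ∑ z ∈ periodBox (d := d) N, ‖f (z + e κ)‖) := by
        rw [Finset.sum_comm]; simp only [Finset.sum_add_distrib]
    _ = ∑ _κ : Fin d, 2 * ∑ z ∈ periodBox (d := d) N, ‖f z‖ := by
        refine Finset.sum_congr rfl fun κ _ => ?_; rw [hshift κ]; ring
    _ = 2 * d * ∑ z ∈ periodBox (d := d) N, ‖f z‖ := by simp [Finset.sum_const, Finset.card_univ]; ring

/-! ## §2 The accumulated frames in `ℓ¹` -/

/-- **THE ACCUMULATED FRAMES IN `ℓ¹`** (tower class: `W` unitary `(tower L N (j+1))`-periodic, `0 ≤ x`, `LevelSmall d L j x`, `SmallField W x`, `L, N ≥ 1`;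
`Y` `(tower L N (j+1))`-periodic; the summed ℓ¹-curvature line of B1):
`Σ_{z∈periodBox N}‖framePotW L (j+1) W Y z‖ ≤ dL(2nbRad+1)^d·3·(Σ_{m≤j}(L∕L^d)^m)·dirL1 Y (periodBox (tower L N (j+1)))` — the frames do NOT contract. [folklore] -/
theorem sum_norm_framePotW_le [Nonempty n] {L N : ℕ} (hL : 1 ≤ L) (hN : 1 ≤ N) (j : ℕ) {W : Site d → Fin d → (Matrix n n ℂ)ˣ} {x : ℝ}
    (hWu : IsUnitaryCfg W) (hWP : IsPeriodicCfg W ((tower L N (j + 1) : ℕ) : ℤ)) (hx : 0 ≤ x) (hsm : LevelSmall d L j x) (hWx : SmallField W x)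
    {Y : Site d → Fin d → (Matrix n n ℂ)} (hYP : IsPeriodicDir Y ((tower L N (j + 1) : ℕ) : ℤ))
    (hA : ((L : ℝ) ^ d / L * (d * (2 * nbRad d L + 1) ^ d)) * curvSum d L (j + 1) x ≤ 2 / 3) :
    ∑ z ∈ periodBox (d := d) N, ‖framePotW L (j + 1) W Y z‖
      ≤ ((d : ℝ) * L) * (2 * nbRad d L + 1) ^ d * (3 * ∑ m ∈ range (j + 1), ((L : ℝ) / (L : ℝ) ^ d) ^ m)
          * dirL1 Y (periodBox (d := d) (tower L N (j + 1))) := by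
  haveI : NeZero L := ⟨by omega⟩
  haveI : NeZero N := ⟨by omega⟩
  set T := dirL1 Y (periodBox (d := d) (tower L N (j + 1))) with hT
  have hT0 : 0 ≤ T := dirL1_nonneg _ _
  set Cf : ℝ := ((d : ℝ) * L) * (2 * nbRad d L + 1) ^ d with hCf
  have hCf0 : 0 ≤ Cf := by positivity
  -- level-wise: the `m`-th frame summed over the corner sites
  have hlev : ∀ m ∈ range (j + 1),
      ∑ z ∈ periodBox (d := d) N, ‖Fbar L (cavgIter L m W) (QbarIter L m W Y) (((L : ℤ) ^ (j + 1 - 1 - m)) • z)‖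
        ≤ Cf * (3 * ((L : ℝ) / (L : ℝ) ^ d) ^ m * T) := by
    intro m hm
    have hmj : m ≤ j := Nat.lt_succ_iff.mp (Finset.mem_range.mp hm)
    -- the level-`m` data: background unitary, field periodic with period `tower L N (j+1-m) = L · tower L N (j-m)`
    obtain ⟨hUm, -, -, -⟩ := levelData hL hWu hx hsm hWx (m := m) (by omega)
    have hTm : tower L N (j + 1) = tower L (tower L N (j + 1 - m)) m := by
      have : ∀ a b : ℕ, tower L N (a + b) = tower L (tower L N a) b := by
        intro a b; induction b with
        | zero => rfl
        | succ b ih => show L * tower L N (a + b) = L * tower L (tower L N a) b; rw [ih]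
      rw [← this]; congr 1; omega
    have hWPm : IsPeriodicCfg W ((tower L (tower L N (j + 1 - m)) m : ℕ) : ℤ) := by rw [← hTm]; exact hWP
    have hYPm : IsPeriodicDir Y ((tower L (tower L N (j + 1 - m)) m : ℕ) : ℤ) := by rw [← hTm]; exact hYP
    have hQP : IsPeriodicDir (QbarIter L m W Y) ((tower L N (j + 1 - m) : ℕ) : ℤ) := isPeriodicDir_QbarIter L _ m hWPm hYPm
    have hsplit : tower L N (j + 1 - m) = L * tower L N (j - m) := by
      rw [show j + 1 - m = (j - m) + 1 by omega]; rfl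
    have hQP' : IsPeriodicDir (QbarIter L m W Y) ((L : ℤ) * (tower L N (j - m) : ℕ)) := by
      have e : ((tower L N (j + 1 - m) : ℕ) : ℤ) = (L : ℤ) * (tower L N (j - m) : ℕ) := by rw [hsplit]; push_cast; ring
      rw [← e]; exact hQP
    have hTjm : 1 ≤ tower L N (j - m) := Nat.one_le_iff_ne_zero.mpr (AveragingDeficitMultiLevelPrep.tower_ne_zero L N _)
    -- corner sub-sum ≤ full level sum, then the one-frame letter, then B1
    have h1 : ∑ z ∈ periodBox (d := d) N, ‖Fbar L (cavgIter L m W) (QbarIter L m W Y) (((L : ℤ) ^ (j + 1 - 1 - m)) • z)‖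
        ≤ ∑ y ∈ periodBox (d := d) (tower L N (j - m)), ‖Fbar L (cavgIter L m W) (QbarIter L m W Y) y‖ := by
      rw [show j + 1 - 1 - m = j - m by omega]
      exact sum_corner_pow_le hL (j - m) (g := fun y => ‖Fbar L (cavgIter L m W) (QbarIter L m W Y) y‖) (fun _ => norm_nonneg _)
    have h2 := sum_norm_Fbar_le hL hTjm hUm hQP'
    rw [← hsplit] at h2
    have h3 := dirL1_QbarIter_le_of_le hL hN hWu hWP hx hsm hWx hYP hA (m := m) (by omega)
    calc _ ≤ _ := h1
      _ ≤ Cf * dirL1 (QbarIter L m W Y) (periodBox (d := d) (tower L N (j + 1 - m))) := h2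
      _ ≤ Cf * (3 * ((L : ℝ) / (L : ℝ) ^ d) ^ m * T) := mul_le_mul_of_nonneg_left h3 hCf0
  calc ∑ z ∈ periodBox (d := d) N, ‖framePotW L (j + 1) W Y z‖
      = ∑ z ∈ periodBox (d := d) N, ‖∑ m ∈ range (j + 1), Fbar L (cavgIter L m W) (QbarIter L m W Y) (((L : ℤ) ^ (j + 1 - 1 - m)) • z)‖ := by
        refine Finset.sum_congr rfl fun z _ => ?_; rw [framePotW_eq_sum]
    _ ≤ ∑ z ∈ periodBox (d := d) N, ∑ m ∈ range (j + 1), ‖Fbar L (cavgIter L m W) (QbarIter L m W Y) (((L : ℤ) ^ (j + 1 - 1 - m)) • z)‖ :=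
        Finset.sum_le_sum fun z _ => norm_sum_le _ _
    _ = ∑ m ∈ range (j + 1), ∑ z ∈ periodBox (d := d) N, ‖Fbar L (cavgIter L m W) (QbarIter L m W Y) (((L : ℤ) ^ (j + 1 - 1 - m)) • z)‖ :=
        Finset.sum_comm
    _ ≤ ∑ m ∈ range (j + 1), Cf * (3 * ((L : ℝ) / (L : ℝ) ^ d) ^ m * T) := Finset.sum_le_sum hlev
    _ = Cf * (3 * ∑ m ∈ range (j + 1), ((L : ℝ) / (L : ℝ) ^ d) ^ m) * T := by
        simp only [Finset.mul_sum, Finset.sum_mul]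
        exact Finset.sum_congr rfl fun m _ => by ring

/-! ## §3 The ℓ¹ letter of the linearised k-fold average -/

/-- **THE ℓ¹ LETTER OF `dirIter`, k-FREE** (tower class as in §2, `Y` skew periodic):
`dirL1 (dirIter L (j+1) W Y) (periodBox N) ≤ (3(L∕L^d)^{j+1} + 2d·(dL(2nbRad+1)^d·3·Σ_{m≤j}(L∕L^d)^m))·dirL1 Y (periodBox (tower L N (j+1)))` — the straight part
contracts, the frame part is carried. [folklore] -/
theorem dirL1_dirIter_le [Nonempty n] {L N : ℕ} (hL : 1 ≤ L) (hN : 1 ≤ N) (j : ℕ) {W : Site d → Fin d → (Matrix n n ℂ)ˣ} {x : ℝ}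
    (hWu : IsUnitaryCfg W) (hWP : IsPeriodicCfg W ((tower L N (j + 1) : ℕ) : ℤ)) (hx : 0 ≤ x) (hsm : LevelSmall d L j x) (hWx : SmallField W x)
    {Y : Site d → Fin d → (Matrix n n ℂ)} (hYs : IsSkewDir Y) (hYP : IsPeriodicDir Y ((tower L N (j + 1) : ℕ) : ℤ))
    (hA : ((L : ℝ) ^ d / L * (d * (2 * nbRad d L + 1) ^ d)) * curvSum d L (j + 1) x ≤ 2 / 3) :
    dirL1 (dirIter L (j + 1) W Y) (periodBox (d := d) N)
      ≤ (3 * ((L : ℝ) / (L : ℝ) ^ d) ^ (j + 1)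
          + 2 * d * (((d : ℝ) * L) * (2 * nbRad d L + 1) ^ d * (3 * ∑ m ∈ range (j + 1), ((L : ℝ) / (L : ℝ) ^ d) ^ m)))
        * dirL1 Y (periodBox (d := d) (tower L N (j + 1))) := by
  haveI : NeZero L := ⟨by omega⟩
  haveI : NeZero N := ⟨by omega⟩
  set T := dirL1 Y (periodBox (d := d) (tower L N (j + 1))) with hT
  have hstruct := dirIter_eq_QbarIter_add_gaugeDir (M := N) hL j hWu hWP hx hsm hWx hYs hYP
  -- the top background is unitary and `N`-periodic; the accumulated frame is `N`-periodic
  obtain ⟨hUtop, -, -, -⟩ := levelData hL hWu hx hsm hWx (m := j + 1) le_rfl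
  have hQ := dirL1_QbarIter_le_of_le hL hN hWu hWP hx hsm hWx hYP hA (m := j + 1) le_rfl
  rw [Nat.sub_self] at hQ
  change dirL1 (QbarIter L (j + 1) W Y) (periodBox (d := d) N) ≤ _ at hQ
  have hF := sum_norm_framePotW_le hL hN j hWu hWP hx hsm hWx hYP hA
  -- periodicity of the accumulated frame on the top torus
  have hfP : ∀ (z : Site d) (i : Fin d), framePotW L (j + 1) W Y (z + (N : ℤ) • e i) = framePotW L (j + 1) W Y z := by
    intro z i
    rw [framePotW_eq_sum, framePotW_eq_sum]
    refine Finset.sum_congr rfl fun m hm => ?_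
    have hmj : m ≤ j := Nat.lt_succ_iff.mp (Finset.mem_range.mp hm)
    have hTm : tower L N (j + 1) = tower L (tower L N (j + 1 - m)) m := by
      have : ∀ a b : ℕ, tower L N (a + b) = tower L (tower L N a) b := by
        intro a b; induction b with
        | zero => rfl
        | succ b ih => show L * tower L N (a + b) = L * tower L (tower L N a) b; rw [ih]
      rw [← this]; congr 1; omega
    have hWPm : IsPeriodicCfg W ((tower L (tower L N (j + 1 - m)) m : ℕ) : ℤ) := by rw [← hTm]; exact hWP
    have hYPm : IsPeriodicDir Y ((tower L (tower L N (j + 1 - m)) m : ℕ) : ℤ) := by rw [← hTm]; exact hYP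
    have hQP : IsPeriodicDir (QbarIter L m W Y) ((tower L N (j + 1 - m) : ℕ) : ℤ) := isPeriodicDir_QbarIter L _ m hWPm hYPm
    have hUmP : IsPeriodicCfg (cavgIter L m W) ((tower L N (j + 1 - m) : ℕ) : ℤ) := isPeriodicCfg_cavgIter L _ m hWPm
    -- `Fbar` of periodic data is periodic on the coarse lattice: shift the corner by `L^{j-m} • (N • e i)` = period of level m+1 data / L
    have e1 : ((L : ℤ) ^ (j + 1 - 1 - m)) • (z + (N : ℤ) • e i) = ((L : ℤ) ^ (j + 1 - 1 - m)) • z + ((tower L N (j - m) : ℕ) : ℤ) • e i := by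
      rw [smul_add, smul_smul, tower_eq_pow_mul, show j + 1 - 1 - m = j - m by omega]; push_cast; ring_nf
    rw [e1]
    have hsplit : ((tower L N (j + 1 - m) : ℕ) : ℤ) = (L : ℤ) * ((tower L N (j - m) : ℕ) : ℤ) := by
      rw [show j + 1 - m = (j - m) + 1 by omega]; exact natCast_tower_succ L N (j - m)
    rw [hsplit] at hQP hUmP
    exact NE3TangentCovariantStructure.Fbar_add_period L hUmP hQP _ i
  have hG := dirL1_gaugeDir_le hN hUtop hfP
  rw [hstruct]
  -- `dirL1 (Q + G) ≤ dirL1 Q + dirL1 G`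
  have hsum : dirL1 (fun z κ => QbarIter L (j + 1) W Y z κ + gaugeDir (cavgIter L (j + 1) W) (framePotW L (j + 1) W Y) z κ) (periodBox (d := d) N)
      ≤ dirL1 (QbarIter L (j + 1) W Y) (periodBox (d := d) N) + dirL1 (gaugeDir (cavgIter L (j + 1) W) (framePotW L (j + 1) W Y)) (periodBox (d := d) N) := by
    unfold dirL1
    rw [← Finset.sum_add_distrib]
    refine Finset.sum_le_sum fun z _ => ?_
    rw [← Finset.sum_add_distrib]
    exact Finset.sum_le_sum fun κ _ => norm_add_le _ _
  refine hsum.trans ?_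
  have hd0 : (0 : ℝ) ≤ 2 * d := by positivity
  have hG' := hG.trans (mul_le_mul_of_nonneg_left hF hd0)
  have hT0 : 0 ≤ T := dirL1_nonneg _ _
  nlinarith [hQ, hG', hT0]

/-! ## §4 (appended, gen 95) The frames read only the boxes at the top-corner chains -/

/-- **ONE LINEARISED FRAME, LOCALLY IN `ℓ¹`**: for `U` unitary, `‖Fbar L U Y y‖ ≤ (d·L)·dirL1 Y (box (nbRad d L) (L•y))` — the frame at a coarse site reads the field only in the
`nbRad`-box of the block corner (every tree contour has at most `dL` bonds there; the block weights sum to one). [folklore] -/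
theorem norm_Fbar_le_box {L : ℕ} (hL : 1 ≤ L) {U : Site d → Fin d → (Matrix n n ℂ)ˣ} (hU : IsUnitaryCfg U)
    (Y : Site d → Fin d → Matrix n n ℂ) (y : Site d) :
    ‖Fbar L U Y y‖ ≤ ((d : ℝ) * L) * dirL1 Y (box (nbRad d L) ((L : ℤ) • y)) := by
  have hwt := sum_blockWeight_eq_one (d := d) L hL
  set q : Site d := (L : ℤ) • y with hq
  have hD0 : 0 ≤ dirL1 Y (box (nbRad d L) q) := dirL1_nonneg _ _
  show ‖frameLin L U Y q‖ ≤ _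
  unfold frameLin
  calc ‖∑ r : Fin d → Fin L, (((L : ℝ) ^ d)⁻¹) • AveragingDeficitTransport.dhol U Y q (treeWord (boxVec L r))‖
      ≤ ∑ r : Fin d → Fin L, ‖(((L : ℝ) ^ d)⁻¹) • AveragingDeficitTransport.dhol U Y q (treeWord (boxVec L r))‖ := norm_sum_le _ _
    _ ≤ ∑ _r : Fin d → Fin L, ((L : ℝ) ^ d)⁻¹ * (((d : ℝ) * L) * dirL1 Y (box (nbRad d L) q)) := by
        refine Finset.sum_le_sum fun r _ => ?_
        rw [norm_smul, Real.norm_eq_abs, abs_of_nonneg (by positivity)]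
        refine mul_le_mul_of_nonneg_left ?_ (by positivity)
        have hlen : (treeWord (boxVec L r)).length ≤ d * L := by rw [length_treeWord]; exact l1_boxVec_le L r
        have h := lnorm_le_region Y (z := q) (q := q) (R := nbRad d L) (treeWord (boxVec L r))
          (by rw [BlockAverageVaryHolo.l1_sub_self, zero_add, length_treeWord, nbRad]; have := l1_boxVec_le L r; nlinarith)
        refine (norm_dhol_le hU Y _ _).trans (h.trans ?_)
        exact mul_le_mul_of_nonneg_right (by exact_mod_cast hlen) hD0
    _ = ((d : ℝ) * L) * dirL1 Y (box (nbRad d L) q) := by rw [← Finset.sum_mul, hwt, one_mul]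

/-- **THE ACCUMULATED FRAMES READ ONLY THE TOP-CORNER CHAINS** (tower class as in §2): `Σ_{z∈periodBox N}‖framePotW L (j+1) W Y z‖ ≤
dL·Σ_{m≤j} Σ_{z∈periodBox N} dirL1 (QbarIter L m W Y) (box nbRad ((L^{j+1−m})•z))` — level by level, the ℓ¹ mass of the double-bar field in the `nbRad`-boxes (level-`m` units)
around the chain of nested corners of the top sites; the sharp input of the remainder telescope of (S2) (the global form is `sum_norm_framePotW_le`). [folklore] -/
theorem sum_norm_framePotW_le_boxes [Nonempty n] {L N : ℕ} (hL : 1 ≤ L) (j : ℕ) {W : Site d → Fin d → (Matrix n n ℂ)ˣ} {x : ℝ}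
    (hWu : IsUnitaryCfg W) (hx : 0 ≤ x) (hsm : LevelSmall d L j x) (hWx : SmallField W x) (Y : Site d → Fin d → (Matrix n n ℂ)) :
    ∑ z ∈ periodBox (d := d) N, ‖framePotW L (j + 1) W Y z‖
      ≤ ((d : ℝ) * L) * ∑ m ∈ range (j + 1), ∑ z ∈ periodBox (d := d) N,
          dirL1 (QbarIter L m W Y) (box (nbRad d L) (((L : ℤ) ^ (j + 1 - m)) • z)) := by
  have hlev : ∀ m ∈ range (j + 1), ∀ z : Site d,
      ‖Fbar L (cavgIter L m W) (QbarIter L m W Y) (((L : ℤ) ^ (j + 1 - 1 - m)) • z)‖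
        ≤ ((d : ℝ) * L) * dirL1 (QbarIter L m W Y) (box (nbRad d L) (((L : ℤ) ^ (j + 1 - m)) • z)) := by
    intro m hm z
    have hmj : m ≤ j := Nat.lt_succ_iff.mp (Finset.mem_range.mp hm)
    obtain ⟨hUm, -, -, -⟩ := levelData hL hWu hx hsm hWx (m := m) (by omega)
    have h := norm_Fbar_le_box hL hUm (QbarIter L m W Y) (((L : ℤ) ^ (j + 1 - 1 - m)) • z)
    have e : (L : ℤ) • (((L : ℤ) ^ (j + 1 - 1 - m)) • z) = ((L : ℤ) ^ (j + 1 - m)) • z := by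
      rw [smul_smul, ← pow_succ', show j + 1 - 1 - m + 1 = j + 1 - m by omega]
    rwa [e] at h
  calc ∑ z ∈ periodBox (d := d) N, ‖framePotW L (j + 1) W Y z‖
      = ∑ z ∈ periodBox (d := d) N, ‖∑ m ∈ range (j + 1), Fbar L (cavgIter L m W) (QbarIter L m W Y) (((L : ℤ) ^ (j + 1 - 1 - m)) • z)‖ := by
        refine Finset.sum_congr rfl fun z _ => ?_; rw [framePotW_eq_sum]
    _ ≤ ∑ z ∈ periodBox (d := d) N, ∑ m ∈ range (j + 1), ‖Fbar L (cavgIter L m W) (QbarIter L m W Y) (((L : ℤ) ^ (j + 1 - 1 - m)) • z)‖ :=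
        Finset.sum_le_sum fun z _ => norm_sum_le _ _
    _ ≤ ∑ z ∈ periodBox (d := d) N, ∑ m ∈ range (j + 1), ((d : ℝ) * L) * dirL1 (QbarIter L m W Y) (box (nbRad d L) (((L : ℤ) ^ (j + 1 - m)) • z)) :=
        Finset.sum_le_sum fun z _ => Finset.sum_le_sum fun m hm => hlev m hm z
    _ = ((d : ℝ) * L) * ∑ m ∈ range (j + 1), ∑ z ∈ periodBox (d := d) N, dirL1 (QbarIter L m W Y) (box (nbRad d L) (((L : ℤ) ^ (j + 1 - m)) • z)) := by
        rw [Finset.sum_comm, Finset.mul_sum]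
        refine Finset.sum_congr rfl fun m _ => ?_
        rw [Finset.mul_sum]

end

end Summit.QuantumFields.BalabanUV.T4Continuum.NE7DirIterL1Letter
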